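import Summits.AtomisticToContinuum.Crystallization.Theorems.OverbindingBudgetRegularityCutStatements

/-!
# OverbindingBudget — the UNIFORM CUT, statements: the regularity cut re-typed spacing-uniformly, and the Liouville piece cut into
slack kissing rigidity and Barlow strain exclusion
(helper, `--supports stmt-AtomisticToContinuum-31280`; decomp-a2c lens 4 «minimal counterexample / extremal reduction», generation 25; node
«UniformCut», file 1 of 2 — the blow-down with varying spacing and the cones are `…OverbindingBudgetUniformCutLimit`)

Route `OverbindingBudget` (Crystallization), crux `RobustDefectLimitWindows` (RDEF, stmt-AtomisticToContinuum-31280), registered line v7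
«HostedDustCut» (sha 624a0fa0…, untouched).  Piece of record before this node (generation 24, critic row 335): the cone
`…OverbindingBudgetMuGSCLimit.rdef_of_gross_liouville_coherent' : GrossCleanBalls T₀ 10 → CleanLiouville T₀ 10 → CleanlessExcessT →
CoherentResidual 10 → RDEF` (`0 < T₀`), every law stated AT THE SPACING `a` of the host's thin cores.

## Why re-type (the band-straddling objection, K-LIOU (iii) of generation 24)

The single-spacing laws (`MuCleanBalls`, `GrossCleanBalls`, `CleanLiouville`) ask for clean balls at the SAME admissible spacing `a` at
which the texture is thin-cored.  A `μ`-ground state built from two `L`-dense, crystallographically inequivalent site classes whose bond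
lengths straddle `1.02·a` (an `hcp`-type stacking with its two bond families, say) can be thin-cored at `a`, have NO `t`-clean ball at `a`
for small `t`, and yet be clean at every site at a nearby spacing `a'` — so the single-spacing laws may fail on a texture on which the crux
holds (its `ROBUST` hypothesis quantifies over ALL admissible spacings).  The laws of this node quantify the conclusion's spacing
existentially, exactly as `¬ROBUST` does; the host spacing `b` (thin cores) and the clean spacing `a` are independent parameters.

## Contents (all proofs complete, 0 sorry, over landed Theorems files only)

* §A  `MuCleanBallsU D` (MCBᵘ): a `9/10`-covering uniformly discrete `μ`-ground state at the limiting density, thin-cored at SOME admissible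
  spacing `b`, has for every margin `t ∈ (0, 1/10]` and radius `L` a `t`-clean `L`-ball at SOME admissible spacing `a`.  WEAKER than
  `MuCleanBalls D` (`mcbU_of_mcb`); still closes the hosted world (`hostedTarget_of_mcbU`) and the crux modulo the residuals of record
  (`rdef_of_mcbU_coherent`).
* §B  the severity cut, uniform: `MuCleanBallsU D ⟺ GrossCleanBallsU T₀ D ∧ SoftCleanBallsU T₀ D` (`0 < T₀ ≤ 1/10`); `GrossCleanBallsU` is
  WEAKER than the pricing residual of record `GrossCleanBalls` (`grossU_of_gross`).
* §C  ε-regularity `CleanRegularityU T₀ D` (radius `R` uniform in the clean spacing `a ∈ [47/50, 1]`) and the Liouville statement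
  `CleanLiouvilleU T₀ D` (a globally `T₀`-clean `μ`-ground state at spacing `a`, loosened thin cores at an independent spacing `b`, is globally
  `t`-clean at SOME admissible spacing `a'`, every `t > 0`); `softU_of_regU`.  (`regU_of_liouU`: file 2.)
* §G  the cut of the Liouville piece: `SlackKissingRigidity T₀ ρ` (a FINITE statement: a twelve-point shell with centre distances in
  `[0.98a − T₀, 1.02a + T₀]`, mutual distances `≥ 0.98a − T₀` and none in `(1.02a + T₀, 1.26a − T₀)` is, rescaled by `a⁻¹`, `ρ`-close to the
  fcc or the hcp kissing pattern after a linear isometry — Fejes Tóth's problem / Hales 2012 with slack) and `BarlowStrainExclusion T₀ ρ D`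
  (the Liouville statement on textures whose every `T₀`-shell is `ρ`-Barlow-close); glue `liouU_of_kissing_strain` (`T₀ ≤ 1/10`).
-/

namespace Summit.AtomisticToContinuum.Crystallization.Theorems.OverbindingBudgetUniformCutStatements

open Filter Metric Set Topology
open scoped BigOperators
open Literature.MathematicalPhysics.StatisticalMechanics
open Literature.Geometry.DiscreteGeometry (ShellCloseTo fccKissingPattern hcpKissingPattern)
open Summit.AtomisticToContinuum.Crystallization.Theses.OverbindingBudget (RobustDefectLimitWindows)
open Summit.AtomisticToContinuum.Crystallization.Theorems.OverbindingBudgetViolatorDensityFloor (GT RT)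
open Summit.AtomisticToContinuum.Crystallization.Theorems.OverbindingBudgetWallTensionLever (BarlowClose MAT CleanT ThinCores)
open Summit.AtomisticToContinuum.Crystallization.Theorems.OverbindingBudgetCleanlessCut (Hosted HostedTarget)
open Summit.AtomisticToContinuum.Crystallization.Theorems.OverbindingBudgetGradedBareness (CleanlessExcessT)
open Summit.AtomisticToContinuum.Crystallization.Theorems.OverbindingBudgetCoherentCut (CoherentResidual rdef_of_hosted_graded_coherent)
open Summit.AtomisticToContinuum.Crystallization.Theorems.OverbindingBudgetRecurrentDustStatements (ThinCoresL ViolatorsL window_finite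
  window_finite_lt rt_mono thinCoresL_of_thinCores)
open Summit.AtomisticToContinuum.Crystallization.Theorems.OverbindingBudgetRegularityCutStatements

/-! ## §A  The extremal class, spacing-uniformly -/

/-- **`MuCleanBallsU D`** (MCBᵘ).  For every limiting energy density `e` (`TEND`, `LB`), every uniformly discrete `9/10`-covering `μ`-ground
state `Y` at chemical potential `e` with thin cores of radius `D` at SOME admissible host spacing `b ∈ [47/50, 1]`, every margin
`t ∈ (0, 1/10]` and every radius `L`: at SOME admissible spacing `a ∈ [47/50, 1]` some site `q ∈ Y` has all sites of `Y` within `L` passing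
the relaxed gapped-twelve test `RT a t` — the instance of `¬ROBUST` at `(L, t)`. -/
def MuCleanBallsU (D : ℝ) : Prop :=
  ∀ e : ℝ, Filter.Tendsto (fun N : ℕ => groundStateEnergy lennardJones 3 N / N) Filter.atTop (nhds e) →
    (∀ N : ℕ, 0 < N → e ≤ groundStateEnergy lennardJones 3 N / N) →
    ∀ Y : Set (EuclideanSpace ℝ (Fin 3)), UniformlyDiscrete Y → (∀ z : EuclideanSpace ℝ (Fin 3), ∃ w ∈ Y, dist z w < 9 / 10) →
      IsMuGSC lennardJones e Y →
      ∀ b : ℝ, 47 / 50 ≤ b → b ≤ 1 → ThinCores b D Y → ∀ t : ℝ, 0 < t → t ≤ 1 / 10 → ∀ L : ℝ,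
        ∃ a : ℝ, 47 / 50 ≤ a ∧ a ≤ 1 ∧ ∃ q ∈ Y, ∀ y ∈ Y, dist y q ≤ L → RT a t Y y

/-- The single-spacing law gives the uniform one (take the host spacing). [this file] -/
theorem mcbU_of_mcb {D : ℝ} (h : MuCleanBalls D) : MuCleanBallsU D :=
  fun e hT hlb Y hUD hsolid hμ b hb1 hb2 hthin t ht ht1 L =>
    ⟨b, hb1, hb2, h e hT hlb Y hUD hsolid hμ b hb1 hb2 t ht ht1 L hthin⟩

/-- Monotonicity in the core radius. [this file] -/
theorem mcbU_mono {D D' : ℝ} (hDD : D ≤ D') (h : MuCleanBallsU D') : MuCleanBallsU D := by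
  intro e hT hlb Y hUD hsolid hμ b hb1 hb2 hthin t ht ht1 L
  exact h e hT hlb Y hUD hsolid hμ b hb1 hb2 (fun z => by
    obtain ⟨y, hy, hg, hb, hd⟩ := hthin z
    exact ⟨y, hy, hg, hb, hd.trans hDD⟩) t ht ht1 L

/-- **`MuCleanBallsU 10` closes the hosted world.**  In `HostedTarget 10` the texture is a `μ`-ground state at `e`, hosted (thin cores of
radius `10` at some admissible spacing `b`), and `ROBUST` supplies a margin `t > 0` and a radius `L` with `t`-robust violators `L`-dense at
EVERY admissible spacing; the law at margin `min t (1/10)` exhibits an admissible spacing `a` and a clean `L`-ball at `a`, whose centre has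
no violator within `L` at spacing `a` (`rt_mono`).  Contradiction; the windows follow vacuously. [this file] -/
theorem hostedTarget_of_mcbU (h : MuCleanBallsU 10) : HostedTarget 10 := by
  unfold HostedTarget
  intro e hT hlb x hx Y h0 hrec hlim hUD hμ hgap hsolid haper hup hlow hacc htwo hthin hrob hh
  obtain ⟨b, hb1, hb2, _hmat, hthin'⟩ := hh
  obtain ⟨L, t, ht, hr⟩ := hrob
  obtain ⟨a, ha1, ha2, q, hq, hall⟩ :=
    h e hT hlb Y hUD hsolid hμ b hb1 hb2 hthin' (min t (1 / 10)) (lt_min ht (by norm_num)) (min_le_right _ _) L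
  obtain ⟨y, hy, hd, hn⟩ := hr q hq a ha1 ha2
  exact absurd (rt_mono hUD (min_le_left _ _) (hall y hy hd)) hn

/-- **The cone through the uniform extremal class.**  `MuCleanBallsU 10 ∧ CleanlessExcessT ∧ CoherentResidual 10 ⟹ RDEF`. [this file] -/
theorem rdef_of_mcbU_coherent (h : MuCleanBallsU 10) (hCE : CleanlessExcessT) (hR : CoherentResidual 10) :
    RobustDefectLimitWindows :=
  rdef_of_hosted_graded_coherent (hostedTarget_of_mcbU h) hCE hR

/-! ## §B  The severity cut, spacing-uniformly -/

/-- **`GrossCleanBallsU T₀ D`** (GROSSᵘ) — the uniform law at the single margin `T₀`: a thin-cored (at some admissible `b`) `9/10`-covering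
uniformly discrete `μ`-ground state at the limiting density has `T₀`-clean balls of every radius, each at SOME admissible spacing.  At
`T₀ = 1/250` the violators it excludes at density are the GROSS ones at every admissible spacing at once: the PRICING residual. -/
def GrossCleanBallsU (T₀ D : ℝ) : Prop :=
  ∀ e : ℝ, Filter.Tendsto (fun N : ℕ => groundStateEnergy lennardJones 3 N / N) Filter.atTop (nhds e) →
    (∀ N : ℕ, 0 < N → e ≤ groundStateEnergy lennardJones 3 N / N) →
    ∀ Y : Set (EuclideanSpace ℝ (Fin 3)), UniformlyDiscrete Y → (∀ z : EuclideanSpace ℝ (Fin 3), ∃ w ∈ Y, dist z w < 9 / 10) →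
      IsMuGSC lennardJones e Y →
      ∀ b : ℝ, 47 / 50 ≤ b → b ≤ 1 → ThinCores b D Y → ∀ L : ℝ,
        ∃ a : ℝ, 47 / 50 ≤ a ∧ a ≤ 1 ∧ ∃ q ∈ Y, ∀ y ∈ Y, dist y q ≤ L → RT a T₀ Y y

/-- **`SoftCleanBallsU T₀ D`** (SOFTᵘ) — the uniform law below the threshold, on textures that already have `T₀`-clean balls of every
radius (each at some admissible spacing): they have `t`-clean balls of every radius at some admissible spacing, every `t ∈ (0, 1/10]`. -/
def SoftCleanBallsU (T₀ D : ℝ) : Prop :=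
  ∀ e : ℝ, Filter.Tendsto (fun N : ℕ => groundStateEnergy lennardJones 3 N / N) Filter.atTop (nhds e) →
    (∀ N : ℕ, 0 < N → e ≤ groundStateEnergy lennardJones 3 N / N) →
    ∀ Y : Set (EuclideanSpace ℝ (Fin 3)), UniformlyDiscrete Y → (∀ z : EuclideanSpace ℝ (Fin 3), ∃ w ∈ Y, dist z w < 9 / 10) →
      IsMuGSC lennardJones e Y →
      ∀ b : ℝ, 47 / 50 ≤ b → b ≤ 1 → ThinCores b D Y →
        (∀ R : ℝ, ∃ a : ℝ, 47 / 50 ≤ a ∧ a ≤ 1 ∧ ∃ q ∈ Y, ∀ y ∈ Y, dist y q ≤ R → RT a T₀ Y y) →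
        ∀ t : ℝ, 0 < t → t ≤ 1 / 10 → ∀ L : ℝ,
          ∃ a : ℝ, 47 / 50 ≤ a ∧ a ≤ 1 ∧ ∃ q ∈ Y, ∀ y ∈ Y, dist y q ≤ L → RT a t Y y

/-- The uniform gross law is the uniform extremal law at one margin. [this file] -/
theorem grossU_of_mcbU {T₀ D : ℝ} (hT : 0 < T₀) (hT1 : T₀ ≤ 1 / 10) (h : MuCleanBallsU D) : GrossCleanBallsU T₀ D :=
  fun e hT' hlb Y hUD hsolid hμ b hb1 hb2 hthin L => h e hT' hlb Y hUD hsolid hμ b hb1 hb2 hthin T₀ hT hT1 L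

/-- The uniform soft law is the uniform extremal law with an extra hypothesis. [this file] -/
theorem softU_of_mcbU {T₀ D : ℝ} (h : MuCleanBallsU D) : SoftCleanBallsU T₀ D :=
  fun e hT' hlb Y hUD hsolid hμ b hb1 hb2 hthin _ t ht ht1 L => h e hT' hlb Y hUD hsolid hμ b hb1 hb2 hthin t ht ht1 L

/-- **The uniform severity cut glues.**  `GrossCleanBallsU T₀ D ∧ SoftCleanBallsU T₀ D ⟹ MuCleanBallsU D`: margins `t ≥ T₀` from the gross
law by monotonicity of `RT` in the margin (same spacing), margins `t < T₀` from the soft law, whose hypothesis the gross law supplies.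
[this file] -/
theorem mcbU_of_grossU_softU {T₀ D : ℝ} (hG : GrossCleanBallsU T₀ D) (hS : SoftCleanBallsU T₀ D) : MuCleanBallsU D := by
  intro e hT' hlb Y hUD hsolid hμ b hb1 hb2 hthin t ht ht1 L
  by_cases hle : T₀ ≤ t
  · obtain ⟨a, ha1, ha2, q, hq, hall⟩ := hG e hT' hlb Y hUD hsolid hμ b hb1 hb2 hthin L
    exact ⟨a, ha1, ha2, q, hq, fun y hy hd => rt_mono hUD hle (hall y hy hd)⟩
  · exact hS e hT' hlb Y hUD hsolid hμ b hb1 hb2 hthin (fun R => hG e hT' hlb Y hUD hsolid hμ b hb1 hb2 hthin R) t ht ht1 L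

/-- **The uniform severity cut is exact:** `MuCleanBallsU D ⟺ GrossCleanBallsU T₀ D ∧ SoftCleanBallsU T₀ D`, every `T₀ ∈ (0, 1/10]`.
[this file] -/
theorem mcbU_iff_grossU_softU {T₀ D : ℝ} (hT : 0 < T₀) (hT1 : T₀ ≤ 1 / 10) :
    MuCleanBallsU D ↔ GrossCleanBallsU T₀ D ∧ SoftCleanBallsU T₀ D :=
  ⟨fun h => ⟨grossU_of_mcbU hT hT1 h, softU_of_mcbU h⟩, fun h => mcbU_of_grossU_softU h.1 h.2⟩

/-- **The uniform gross law is WEAKER than the pricing residual of record** `GrossCleanBalls T₀ D` (take the host spacing). [this file] -/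
theorem grossU_of_gross {T₀ D : ℝ} (h : GrossCleanBalls T₀ D) : GrossCleanBallsU T₀ D :=
  fun e hT hlb Y hUD hsolid hμ b hb1 hb2 hthin L => ⟨b, hb1, hb2, h e hT hlb Y hUD hsolid hμ b hb1 hb2 L hthin⟩

/-- Monotonicity of the uniform gross law in the threshold. [this file] -/
theorem grossU_mono {T₀ T₁ D : ℝ} (hTT : T₀ ≤ T₁) (h : GrossCleanBallsU T₀ D) : GrossCleanBallsU T₁ D := by
  intro e hT' hlb Y hUD hsolid hμ b hb1 hb2 hthin L
  obtain ⟨a, ha1, ha2, q, hq, hall⟩ := h e hT' hlb Y hUD hsolid hμ b hb1 hb2 hthin L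
  exact ⟨a, ha1, ha2, q, hq, fun y hy hd => rt_mono hUD hTT (hall y hy hd)⟩

/-- Monotonicity of the uniform gross law in the core radius. [this file] -/
theorem grossU_mono_radius {T₀ D D' : ℝ} (hDD : D ≤ D') (h : GrossCleanBallsU T₀ D') : GrossCleanBallsU T₀ D := by
  intro e hT hlb Y hUD hsolid hμ b hb1 hb2 hthin L
  exact h e hT hlb Y hUD hsolid hμ b hb1 hb2 (fun z => by
    obtain ⟨y, hy, hg, hb, hd⟩ := hthin z
    exact ⟨y, hy, hg, hb, hd.trans hDD⟩) L

/-- **The uniform cut cone.**  `GrossCleanBallsU T₀ 10 ∧ SoftCleanBallsU T₀ 10 ∧ CleanlessExcessT ∧ CoherentResidual 10 ⟹ RDEF`. [this file] -/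
theorem rdef_of_grossU_softU_coherent {T₀ : ℝ} (hG : GrossCleanBallsU T₀ 10) (hS : SoftCleanBallsU T₀ 10) (hCE : CleanlessExcessT)
    (hR : CoherentResidual 10) : RobustDefectLimitWindows :=
  rdef_of_mcbU_coherent (mcbU_of_grossU_softU hG hS) hCE hR

/-! ## §C  ε-regularity and the Liouville statement, spacing-uniformly -/

/-- **`CleanRegularityU T₀ D`** (REGᵘ) — ε-regularity of `μ`-ground states with the radius UNIFORM in the clean spacing: for every
limiting density `e`, separation `δ`, host spacing `b`, margin `t ∈ (0, 1/10]` and radius `L` there is `R` such that in every `δ`-separated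
`9/10`-covering `μ`-ground state at `e` with thin cores of radius `D` at `b`, every `R`-ball `B(q, R)` that is `T₀`-clean at ANY admissible
spacing `a` contains an `L`-ball `B(q', L)`, `dist q' q ≤ R`, that is `t`-clean at SOME admissible spacing `a'`. -/
def CleanRegularityU (T₀ D : ℝ) : Prop :=
  ∀ e : ℝ, Filter.Tendsto (fun N : ℕ => groundStateEnergy lennardJones 3 N / N) Filter.atTop (nhds e) →
    (∀ N : ℕ, 0 < N → e ≤ groundStateEnergy lennardJones 3 N / N) →
    ∀ δ : ℝ, 0 < δ → ∀ b : ℝ, 47 / 50 ≤ b → b ≤ 1 → ∀ t : ℝ, 0 < t → t ≤ 1 / 10 → ∀ L : ℝ, ∃ R : ℝ,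
      ∀ Y : Set (EuclideanSpace ℝ (Fin 3)), (∀ p ∈ Y, ∀ q ∈ Y, p ≠ q → δ ≤ dist p q) →
        (∀ z : EuclideanSpace ℝ (Fin 3), ∃ w ∈ Y, dist z w < 9 / 10) → IsMuGSC lennardJones e Y → ThinCores b D Y →
        ∀ a : ℝ, 47 / 50 ≤ a → a ≤ 1 → ∀ q ∈ Y, (∀ y ∈ Y, dist y q ≤ R → RT a T₀ Y y) →
          ∃ a' : ℝ, 47 / 50 ≤ a' ∧ a' ≤ 1 ∧ ∃ q' ∈ Y, dist q' q ≤ R ∧ ∀ y ∈ Y, dist y q' ≤ L → RT a' t Y y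

/-- **Uniform ε-regularity gives the uniform soft law**: apply it inside one of the `T₀`-clean `R`-balls of the hypothesis. [this file] -/
theorem softU_of_regU {T₀ D : ℝ} (h : CleanRegularityU T₀ D) : SoftCleanBallsU T₀ D := by
  intro e hT' hlb Y hUD hsolid hμ b hb1 hb2 hthin hballs t ht ht1 L
  obtain ⟨δ, hδ, hsep⟩ := hUD
  obtain ⟨R, hR⟩ := h e hT' hlb δ hδ b hb1 hb2 t ht ht1 L
  obtain ⟨a, ha1, ha2, q, hq, hclean⟩ := hballs R
  obtain ⟨a', ha1', ha2', q', hq', -, hgood⟩ := hR Y hsep hsolid hμ hthin a ha1 ha2 q hq hclean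
  exact ⟨a', ha1', ha2', q', hq', hgood⟩

/-- **`CleanLiouvilleU T₀ D`** (LIOUᵘ) — the blow-down statement, spacing-uniformly: a uniformly discrete `9/10`-covering (closed form)
`μ`-ground state at a limiting density `e`, with loosened thin cores of radius `D` at an admissible HOST spacing `b`, which passes the relaxed
test `RT a T₀` at EVERY site at an admissible spacing `a` (globally `T₀`-clean), passes `RT a' t` at every site at SOME admissible spacing
`a'`, for every `t > 0`.  («A globally `T₀`-clean ground state carries no `t`-robust violators at the right spacing.») -/
def CleanLiouvilleU (T₀ D : ℝ) : Prop :=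
  ∀ e : ℝ, Filter.Tendsto (fun N : ℕ => groundStateEnergy lennardJones 3 N / N) Filter.atTop (nhds e) →
    (∀ N : ℕ, 0 < N → e ≤ groundStateEnergy lennardJones 3 N / N) →
    ∀ Y : Set (EuclideanSpace ℝ (Fin 3)), UniformlyDiscrete Y → (∀ z : EuclideanSpace ℝ (Fin 3), ∃ w ∈ Y, dist z w ≤ 9 / 10) →
      IsMuGSC lennardJones e Y → ∀ b : ℝ, 47 / 50 ≤ b → b ≤ 1 → ThinCoresL b D Y →
      ∀ a : ℝ, 47 / 50 ≤ a → a ≤ 1 → (∀ y ∈ Y, RT a T₀ Y y) →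
        ∀ t : ℝ, 0 < t → ∃ a' : ℝ, 47 / 50 ≤ a' ∧ a' ≤ 1 ∧ ∀ y ∈ Y, RT a' t Y y

/-- Antitonicity of the uniform Liouville statement in the threshold (a smaller threshold is a stronger hypothesis). [this file] -/
theorem liouU_anti {T₀ T₁ D : ℝ} (hTT : T₀ ≤ T₁) (h : CleanLiouvilleU T₁ D) : CleanLiouvilleU T₀ D :=
  fun e hT' hlb Y hUD hsolid hμ b hb1 hb2 hthin a ha1 ha2 hclean =>
    h e hT' hlb Y hUD hsolid hμ b hb1 hb2 hthin a ha1 ha2 fun y hy => rt_mono hUD hTT (hclean y hy)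

/-- Monotonicity of the uniform Liouville statement in the core radius. [this file] -/
theorem liouU_mono_radius {T₀ D D' : ℝ} (hDD : D ≤ D') (h : CleanLiouvilleU T₀ D') : CleanLiouvilleU T₀ D :=
  fun e hT' hlb Y hUD hsolid hμ b hb1 hb2 hthin =>
    h e hT' hlb Y hUD hsolid hμ b hb1 hb2 fun z => by
      obtain ⟨y, hy, hd, hc⟩ := hthin z
      exact ⟨y, hy, hd.trans hDD, hc⟩

/-! ## §G  The cut of the Liouville piece: slack kissing rigidity and Barlow strain exclusion -/

/-- **`ShellBarlow a T₀ ρ Y y`** — the `T₀`-widened shell of `y` at spacing `a` (the sites `w ≠ y` of `Y` with `dist y w ≤ 1.02a + T₀`),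
recentred at `y` and rescaled by `a⁻¹`, is `ρ`-close to the fcc or the hcp kissing pattern after a linear isometry (`ShellCloseTo`).  At
`T₀ = 0`, `ρ = 1/5` this is the lineage's `BarlowClose a Y y` (`shellBarlow_zero_iff_barlowClose`). -/
def ShellBarlow (a T₀ ρ : ℝ) (Y : Set (EuclideanSpace ℝ (Fin 3))) (y : EuclideanSpace ℝ (Fin 3)) : Prop :=
  ∃ T : Finset (EuclideanSpace ℝ (Fin 3)),
    (↑T : Set (EuclideanSpace ℝ (Fin 3))) = (fun w => a⁻¹ • (w - y)) '' {w ∈ Y | w ≠ y ∧ dist y w ≤ a * (1 + 1 / 50) + T₀} ∧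
    (ShellCloseTo ρ T fccKissingPattern ∨ ShellCloseTo ρ T hcpKissingPattern)

/-- Sanity: `ShellBarlow a 0 (1/5) Y y ↔ BarlowClose a Y y`. [this file] -/
theorem shellBarlow_zero_iff_barlowClose {a : ℝ} {Y : Set (EuclideanSpace ℝ (Fin 3))} {y : EuclideanSpace ℝ (Fin 3)} :
    ShellBarlow a 0 (1 / 5) Y y ↔ BarlowClose a Y y := by
  unfold ShellBarlow BarlowClose
  simp only [add_zero]

/-- **`SlackKissingRigidity T₀ ρ`** (KR) — Fejes Tóth's twelve-sphere problem WITH SLACK, a FINITE statement: for every admissible spacing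
`a ∈ [47/50, 1]`, every centre `y` and every twelve-point set `S` with centre distances in `[0.98a − T₀, 1.02a + T₀]` and mutual distances
`≥ 0.98a − T₀`, none in the gap band `(1.02a + T₀, 1.26a − T₀)`, the shell `S`, recentred at `y` and rescaled by `a⁻¹`, is `ρ`-close to the
fcc or the hcp kissing pattern after a linear isometry.  (At zero slack — contacts exactly `2`, gap `2.52 = 2·1.26` in Hales's units — this is
Hales 2012, Theorem 1 / Lemma 9–10: the contact graph of a member of `𝒱` is the fcc or the hcp graph, tree
`Literature.Geometry.DiscreteGeometry.FejesTothKissingTwelve`, `KissingRigidity`.  The regular icosahedral shell is excluded by the gap band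
iff `(1.02a + T₀)/(0.98a − T₀) < 1.0515`, i.e. `T₀ < 0.0051·a`; recommended `T₀ = 1/250`, `ρ = 1/5`.) -/
def SlackKissingRigidity (T₀ ρ : ℝ) : Prop :=
  ∀ a : ℝ, 47 / 50 ≤ a → a ≤ 1 → ∀ (y : EuclideanSpace ℝ (Fin 3)) (S : Finset (EuclideanSpace ℝ (Fin 3))), S.card = 12 →
    (∀ w ∈ S, a * (1 - 1 / 50) - T₀ ≤ dist y w ∧ dist y w ≤ a * (1 + 1 / 50) + T₀) →
    (∀ w ∈ S, ∀ w' ∈ S, w ≠ w' → a * (1 - 1 / 50) - T₀ ≤ dist w w' ∧ (dist w w' ≤ a * (1 + 1 / 50) + T₀ ∨ a * (63 / 50) - T₀ ≤ dist w w')) →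
    ∃ T : Finset (EuclideanSpace ℝ (Fin 3)), (↑T : Set (EuclideanSpace ℝ (Fin 3))) = (fun w => a⁻¹ • (w - y)) '' ↑S ∧
      (ShellCloseTo ρ T fccKissingPattern ∨ ShellCloseTo ρ T hcpKissingPattern)

/-- **`BarlowStrainExclusion T₀ ρ D`** (SE) — the uniform Liouville statement on textures whose every `T₀`-widened shell is `ρ`-Barlow-close:
a uniformly discrete `9/10`-covering `μ`-ground state at a limiting density, with loosened thin cores at a host spacing `b`, globally
`T₀`-clean at an admissible spacing `a` AND with `ShellBarlow a T₀ ρ Y y` at every site, is globally `t`-clean at SOME admissible spacing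
`a'`, every `t > 0`.  («Defect-free locally close-packed ground states are not grossly strained»: a discrete elastic Liouville statement
plus the pinning of the dilation by the chemical potential.) -/
def BarlowStrainExclusion (T₀ ρ D : ℝ) : Prop :=
  ∀ e : ℝ, Filter.Tendsto (fun N : ℕ => groundStateEnergy lennardJones 3 N / N) Filter.atTop (nhds e) →
    (∀ N : ℕ, 0 < N → e ≤ groundStateEnergy lennardJones 3 N / N) →
    ∀ Y : Set (EuclideanSpace ℝ (Fin 3)), UniformlyDiscrete Y → (∀ z : EuclideanSpace ℝ (Fin 3), ∃ w ∈ Y, dist z w ≤ 9 / 10) →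
      IsMuGSC lennardJones e Y → ∀ b : ℝ, 47 / 50 ≤ b → b ≤ 1 → ThinCoresL b D Y →
      ∀ a : ℝ, 47 / 50 ≤ a → a ≤ 1 → (∀ y ∈ Y, RT a T₀ Y y) → (∀ y ∈ Y, ShellBarlow a T₀ ρ Y y) →
        ∀ t : ℝ, 0 < t → ∃ a' : ℝ, 47 / 50 ≤ a' ∧ a' ≤ 1 ∧ ∀ y ∈ Y, RT a' t Y y

/-- Strain exclusion is the uniform Liouville statement with an extra hypothesis (so WEAKER). [this file] -/
theorem strainExclusion_of_liouU {T₀ ρ D : ℝ} (h : CleanLiouvilleU T₀ D) : BarlowStrainExclusion T₀ ρ D :=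
  fun e hT hlb Y hUD hsolid hμ b hb1 hb2 hthin a ha1 ha2 hclean _ => h e hT hlb Y hUD hsolid hμ b hb1 hb2 hthin a ha1 ha2 hclean

/-- **Slack kissing rigidity makes every shell of a globally `T₀`-clean texture Barlow-close** (`T₀ ≤ 1/10`): the `T₀`-widened shell of a
site `y` passing `RT a T₀` has exactly twelve members (at least twelve by the test; at most twelve since it lies inside the open
`(1.26a − T₀)`-window, which has at most twelve), its centre distances lie in `[0.98a − T₀, 1.02a + T₀]`, and the relaxed test AT EACH MEMBER
gives the mutual lower bound and the gap dichotomy; `SlackKissingRigidity` then applies to the shell as a `Finset`. [this file] -/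
theorem shellBarlow_of_slackKissingRigidity {T₀ ρ a : ℝ} {Y : Set (EuclideanSpace ℝ (Fin 3))} {y : EuclideanSpace ℝ (Fin 3)}
    (hK : SlackKissingRigidity T₀ ρ) (hY : UniformlyDiscrete Y) (ha1 : 47 / 50 ≤ a) (ha2 : a ≤ 1) (hT : T₀ ≤ 1 / 10)
    (hclean : ∀ y ∈ Y, RT a T₀ Y y) (hy : y ∈ Y) : ShellBarlow a T₀ ρ Y y := by
  classical
  set C : Set (EuclideanSpace ℝ (Fin 3)) := {w ∈ Y | w ≠ y ∧ dist y w ≤ a * (1 + 1 / 50) + T₀} with hC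
  have hCfin : C.Finite := window_finite hY y _
  obtain ⟨h1, h2, h3⟩ := hclean y hy
  have hCsub : C ⊆ {w ∈ Y | w ≠ y ∧ dist y w < a * (63 / 50) - T₀} := fun w hw =>
    ⟨hw.1, hw.2.1, by linarith [hw.2.2]⟩
  have hCcard : C.ncard = 12 := le_antisymm ((Set.ncard_le_ncard hCsub (window_finite_lt hY y _)).trans h1) h2
  set S : Finset (EuclideanSpace ℝ (Fin 3)) := hCfin.toFinset with hS
  have hSC : (↑S : Set (EuclideanSpace ℝ (Fin 3))) = C := hCfin.coe_toFinset
  have hScard : S.card = 12 := by rw [← Set.ncard_coe_finset, hSC, hCcard]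
  have hmem : ∀ w, w ∈ S ↔ w ∈ C := fun w => by rw [hS, Set.Finite.mem_toFinset]
  obtain ⟨T, hT', hclose⟩ := hK a ha1 ha2 y S hScard
    (fun w hw => by
      obtain ⟨hwY, hwy, hwd⟩ := (hmem w).1 hw
      exact ⟨(h3 w hwY hwy).1, hwd⟩)
    (fun w hw w' hw' hne => by
      obtain ⟨hwY, -, -⟩ := (hmem w).1 hw
      obtain ⟨hw'Y, -, -⟩ := (hmem w').1 hw'
      exact (hclean w hwY).2.2 w' hw'Y hne.symm)
  exact ⟨T, by rw [hT', hSC], hclose⟩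

/-- **The cut of the Liouville piece glues.**  `SlackKissingRigidity T₀ ρ ∧ BarlowStrainExclusion T₀ ρ D ⟹ CleanLiouvilleU T₀ D`
(`T₀ ≤ 1/10`). [this file] -/
theorem liouU_of_kissing_strain {T₀ ρ D : ℝ} (hT : T₀ ≤ 1 / 10) (hK : SlackKissingRigidity T₀ ρ) (hS : BarlowStrainExclusion T₀ ρ D) :
    CleanLiouvilleU T₀ D :=
  fun e hT' hlb Y hUD hsolid hμ b hb1 hb2 hthin a ha1 ha2 hclean =>
    hS e hT' hlb Y hUD hsolid hμ b hb1 hb2 hthin a ha1 ha2 hclean fun _ hy =>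
      shellBarlow_of_slackKissingRigidity hK hUD ha1 ha2 hT hclean hy

end Summit.AtomisticToContinuum.Crystallization.Theorems.OverbindingBudgetUniformCutStatements
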